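import Mathlib.Order.Antisymmetrization
import Mathlib.Logic.Equiv.Fin.Basic
import Mathlib.Logic.Equiv.Prod
import Literature.Computability.AlgebraicComplexity.DTensorRestriction
import HarnessLib

/-!
# The semiring `T_d(K)` of `d`-tensors modulo restriction-equivalence (`DTensorClass K d`)

Topic `Literature/Computability/AlgebraicComplexity`; sequel to `DTensorRestriction.lean` and the `d`-leg
analogue of the tree's `TensorSemiring.lean` (`TensorClass K`, `k = 3`). Christandl–Vrana–Zuiddam, for
multilinear maps of any order `k`:

> "We begin by putting an equivalence relation on tensors to get rid of trivialities. Restriction `≥` and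
> asymptotic restriction `≳` are both preorders … We say `f` and `g` are equivalent … The equivalence
> relation `∼` is in fact the equivalence relation generated by the restriction preorder `≥`. Let `𝒯` be
> the set of `∼`-equivalence classes of `k`-multilinear maps of order `k`. Direct sum and tensor product
> naturally carry over to `𝒯`, and `𝒯` becomes a semiring with additive unit `⟨0⟩` and multiplicative unit
> `⟨1⟩` … Restriction `≥` induces a partial order on `𝒯` … Both behave well with respect to the semiring
> operations, and naturally `n ≥ m` if and only if `⟨n⟩ ≥ ⟨m⟩`."
> [corpus: paper:arxiv-1709.07851 p0005:L1–L7 = CVZ 2023, §1.2, p. 5]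

(Zuiddam 2018, §2.3 "Tensors": "`S = ∪ {F^{n₁} ⊗ ⋯ ⊗ F^{n_k} : n₁, …, n_k ∈ ℕ}` … We identify any
`s, t ∈ S` for which `s ⩽ t` and `t ⩽ s` … With addition `⊕` and multiplication `⊗` the set `S` becomes a
semiring.") This file builds that object for `d` legs, in the format `(Fin d → Fin n) → K` (cubic
formats suffice: every format is equivalent to a cubic one by zero-padding):

* `DFinTensor K d` — `d`-tensors of all cubic formats `Fin n`, preordered by restriction
  (`s ≤ t ↔ DTensor.Restricts t.val s.val`, i.e. `t ≥ s`);
* `DTensorClass K d := Antisymmetrization (DFinTensor K d) (· ≤ ·)` — the quotient by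
  restriction-equivalence (a partial order, from Mathlib);
* `DTensorClass.mk t` — the class of a tensor with any finite index type (relabelled to a `Fin` format;
  independent of the labelling, `DTensorClass.mk_reindex`; invariant under pushing forward along an
  injection of index sets, `DTensorClass.mk_apply_embedMat`);
* the **commutative semiring structure** (for `d ≠ 0`): `mk s + mk t = mk (s ⊕ t)`, `mk s * mk t =
  mk (s ⊗ t)`, `0 = mk ⟨0⟩`, `1 = mk ⟨1⟩`, `(n : DTensorClass K d) = mk ⟨n⟩` (`natCast_eq_mk`),
  `mk ⟨ι⟩ = |ι|` (`mk_unit`), and `mk s ≤ mk t ↔ t ≥ s` (`mk_le_mk_iff`).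

The Strassen-preorder axioms for `≤` (order embedding of `ℕ`, the Archimedean axiom) need a field and
`d ≥ 2` and are proved in `DTensorStrassenPreorder.lean`. Everything here is a definition or a proved
lemma over any commutative semiring `K`; no named facts. Grade: REFEREED.

## References

* M. Christandl, P. Vrana, J. Zuiddam, *Universal points in the asymptotic spectrum of tensors*, JAMS 36
  (2023) = arXiv:1709.07851, §1.2 (p. 5). [ChristandlVranaZuiddam2023]
* J. Zuiddam, PhD thesis (2018), §2.3 "Examples. Tensors". [Zuiddam2018]
* V. Strassen, *The asymptotic spectrum of tensors*, Crelle 384 (1988), §3. [Strassen1988]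

## Design notes

* As in `TensorSemiring.lean`: `Antisymmetrization` supplies the partial order; `+`/`*` are
  `Quotient.map₂` of `⊕`/`⊗` followed by relabelling, well defined by `Restricts.dsum`/`Restricts.kron`;
  the semiring laws hold because the two sides are images of each other under maps of index sets
  (the embedding calculus of `DTensorRestriction.lean`: `reindex_dsum`, `apply_embedMat_dsum`,
  `kron_apply_embedMat`, …), uniformly in `d`.
* The type-class instances (`Preorder`, `Add`, `Mul`, `Zero`, `One`, `CommSemiring`) are on the NEW
  types `DFinTensor K d` / `DTensorClass K d` only — exactly the design of the landed sibling
  `TensorSemiring.lean`, and what the requester's `IsStrassenPreorder (· ≤ ·)` (which takes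
  `[CommSemiring S]`) consumes; no instance on any pre-existing type, no notation.
* `[NeZero d]`: for `d = 0` every format is a scalar and `⟨0⟩ ⊕ t ≠ t`.
-/

noncomputable section

open scoped BigOperators

namespace Literature.Computability.AlgebraicComplexity

universe u

/-! ## Two more facts of the embedding calculus -/

namespace DTensor

variable {K : Type u} [CommSemiring K] {d : ℕ}
variable {ι ι' κ : Type*}

/-- The transposed `0/1` matrix undoes an injective embedding: `E_fᵀ · (E_f · t) = t`
(so `E_f · t` and `t` restrict to each other). [cite: ChristandlVranaZuiddam2023, §1.2] -/
theorem apply_coembedMat_apply_embedMat [Fintype ι] [Fintype κ] [DecidableEq ι] [DecidableEq κ]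
    {f : ι → κ} (hf : Function.Injective f) (t : (Fin d → ι) → K) :
    apply (fun _ (a : ι) (x : κ) => if x = f a then (1 : K) else 0)
      (apply (fun _ => embedMat (K := K) f) t) = t := by
  rw [apply_apply]
  have e : (fun (_ : Fin d) (a : ι) (c : ι) => ∑ x : κ, (if x = f a then (1 : K) else 0) *
      embedMat (K := K) f x c) = fun _ (a : ι) (b : ι) => if b = a then (1 : K) else 0 := by
    funext j a c
    simp only [embedMat_apply, ite_mul, one_mul, zero_mul, Finset.sum_ite_eq', Finset.mem_univ,
      if_true, hf.eq_iff, eq_comm]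
  rw [e]
  exact apply_one t

/-- `E_f · t ≥ t` for `f` injective. [cite: ChristandlVranaZuiddam2023, §1.2] -/
theorem apply_embedMat_restricts [Fintype ι] [Fintype κ] [DecidableEq ι] [DecidableEq κ]
    {f : ι → κ} (hf : Function.Injective f) (t : (Fin d → ι) → K) :
    Restricts (apply (fun _ => embedMat (K := K) f) t) t :=
  ⟨_, (apply_coembedMat_apply_embedMat hf t).symm⟩

/-- A tensor whose index set is empty is a restriction of every tensor (`d ≠ 0`).
[cite: ChristandlVranaZuiddam2023, §1.2] -/
theorem restricts_of_isEmpty [Fintype ι] [IsEmpty κ] [NeZero d] (t : (Fin d → ι) → K)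
    (s : (Fin d → κ) → K) : Restricts t s :=
  ⟨fun _ _ _ => 0, funext fun i => isEmptyElim (i 0)⟩

/-- A tensor whose index set is empty restricts only to zero tensors — and to all of them (`d ≠ 0`).
[cite: ChristandlVranaZuiddam2023, §1.2] -/
theorem restricts_zero_of_isEmpty [Fintype ι] [IsEmpty ι] [NeZero d] (t : (Fin d → ι) → K) :
    Restricts t (0 : (Fin d → κ) → K) :=
  Restricts.zero t

end DTensor

/-! ## Tensors of cubic `Fin` formats, preordered by restriction -/

/-- A coordinate `d`-tensor over `K` of some cubic format `Fin n × ⋯ × Fin n` (Zuiddam 2018, §2.3: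
"`S = ∪ {F^{n₁} ⊗ ⋯ ⊗ F^{n_k}}`"; cubic formats represent every class). [cite: Zuiddam2018, §2.3] -/
structure DFinTensor (K : Type u) (d : ℕ) where
  /-- the common dimension of the legs -/
  n : ℕ
  /-- the entries -/
  val : (Fin d → Fin n) → K

namespace DFinTensor

variable {K : Type u} [CommSemiring K] {d : ℕ}

/-- The **restriction preorder** on `DFinTensor K d`: `s ≤ t` iff `t` restricts to `s` (`t ≥ s` in
CVZ's notation; "Restriction `≥` … [is a] preorder"). [cite: ChristandlVranaZuiddam2023, §1.2] -/
instance : Preorder (DFinTensor K d) where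
  le s t := DTensor.Restricts t.val s.val
  le_refl t := DTensor.Restricts.refl t.val
  le_trans _ _ _ h h' := h'.trans h

/-- Unfolding of `≤`. [cite: ChristandlVranaZuiddam2023, §1.2] -/
theorem le_def (s t : DFinTensor K d) : s ≤ t ↔ DTensor.Restricts t.val s.val := Iff.rfl

/-- A tensor with an arbitrary finite index type, relabelled to its cubic `Fin` format.
[cite: ChristandlVranaZuiddam2023, §1.2] -/
def ofFun {ι : Type*} [Fintype ι] (t : (Fin d → ι) → K) : DFinTensor K d :=
  ⟨Fintype.card ι, DTensor.reindex (Fintype.equivFin ι) t⟩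

omit [CommSemiring K] in
/-- Entries of the relabelled tensor. [cite: ChristandlVranaZuiddam2023, §1.2] -/
theorem ofFun_val {ι : Type*} [Fintype ι] (t : (Fin d → ι) → K) :
    (ofFun t).val = DTensor.reindex (Fintype.equivFin ι) t := rfl

/-- The relabelled tensor restricts to the original. [cite: ChristandlVranaZuiddam2023, §1.2] -/
theorem ofFun_restricts {ι : Type*} [Fintype ι] (t : (Fin d → ι) → K) :
    DTensor.Restricts (ofFun t).val t := by
  classical
  rw [ofFun_val]
  exact DTensor.reindex_restricts _ t

/-- The original tensor restricts to the relabelled one. [cite: ChristandlVranaZuiddam2023, §1.2] -/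
theorem restricts_ofFun {ι : Type*} [Fintype ι] (t : (Fin d → ι) → K) :
    DTensor.Restricts t (ofFun t).val := by
  rw [ofFun_val]
  exact DTensor.restricts_reindex _ t

end DFinTensor

/-! ## The quotient `T_d(K)` -/

/-- **`T_d(K)`, the `d`-tensors over `K` modulo restriction-equivalence** (`s ∼ t ↔ s ≤ t ∧ t ≤ s`), with
the induced partial order (CVZ 2023, §1.2: "the set of `∼`-equivalence classes of multilinear maps of
order `k` … Restriction `≥` induces a partial order"; Zuiddam 2018, §2.3). [cite: ChristandlVranaZuiddam2023, §1.2] -/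
abbrev DTensorClass (K : Type u) [CommSemiring K] (d : ℕ) : Type u :=
  Antisymmetrization (DFinTensor K d) (· ≤ ·)

namespace DTensorClass

open DTensor

variable {K : Type u} [CommSemiring K] {d : ℕ}
variable {ι κ μ : Type*}

/-- The class `[t] ∈ T_d(K)` of a tensor with a finite index type. [cite: ChristandlVranaZuiddam2023, §1.2] -/
def mk [Fintype ι] (t : (Fin d → ι) → K) : DTensorClass K d :=
  toAntisymmetrization (· ≤ ·) (DFinTensor.ofFun t)

/-- Every class is the class of some tensor of a cubic `Fin` format. [cite: ChristandlVranaZuiddam2023, §1.2] -/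
theorem ind {p : DTensorClass K d → Prop} (h : ∀ (n : ℕ) (t : (Fin d → Fin n) → K), p (mk t))
    (x : DTensorClass K d) : p x := by
  induction x using Antisymmetrization.ind with
  | _ t =>
    have hx : toAntisymmetrization (· ≤ ·) t = mk t.val := by
      refine Quotient.sound ⟨?_, ?_⟩
      · exact DFinTensor.ofFun_restricts t.val
      · exact DFinTensor.restricts_ofFun t.val
    rw [hx]
    exact h _ _

/-- **`[s] ≤ [t] ↔ t ≥ s`** for tensors with arbitrary finite index types. [cite: ChristandlVranaZuiddam2023, §1.2] -/
theorem mk_le_mk_iff [Fintype ι] [Fintype κ] {s : (Fin d → ι) → K} {t : (Fin d → κ) → K} :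
    mk s ≤ mk t ↔ Restricts t s := by
  unfold mk
  rw [toAntisymmetrization_le_toAntisymmetrization_iff, DFinTensor.le_def]
  exact ⟨fun h => ((DFinTensor.restricts_ofFun t).trans h).trans (DFinTensor.ofFun_restricts s),
    fun h => ((DFinTensor.ofFun_restricts t).trans h).trans (DFinTensor.restricts_ofFun s)⟩

/-- `[s] = [t]` iff `s` and `t` restrict to each other (CVZ's `∼`). [cite: ChristandlVranaZuiddam2023, §1.2] -/
theorem mk_eq_mk_iff [Fintype ι] [Fintype κ] {s : (Fin d → ι) → K} {t : (Fin d → κ) → K} :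
    mk s = mk t ↔ Restricts t s ∧ Restricts s t := by
  rw [le_antisymm_iff, mk_le_mk_iff, mk_le_mk_iff]

/-- Mutual restriction gives equal classes. [cite: ChristandlVranaZuiddam2023, §1.2] -/
theorem mk_eq_mk [Fintype ι] [Fintype κ] {s : (Fin d → ι) → K} {t : (Fin d → κ) → K}
    (h₁ : Restricts t s) (h₂ : Restricts s t) : mk s = mk t :=
  mk_eq_mk_iff.2 ⟨h₁, h₂⟩

/-- **Relabelling the index type does not change the class** ("isomorphic" tensors). [cite: ChristandlVranaZuiddam2023, §1.2] -/
theorem mk_reindex [Fintype ι] [Fintype κ] (e : ι ≃ κ) (t : (Fin d → ι) → K) :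
    mk (reindex e t) = mk t := by
  classical
  exact mk_eq_mk (restricts_reindex e t) (reindex_restricts e t)

/-- **Pushing forward along an injection of index sets does not change the class** (zero-padding:
`[E_f · t] = [t]`). [cite: ChristandlVranaZuiddam2023, §1.2] -/
theorem mk_apply_embedMat [Fintype ι] [Fintype κ] [DecidableEq κ] {f : ι → κ}
    (hf : Function.Injective f) (t : (Fin d → ι) → K) :
    mk (apply (fun _ => embedMat (K := K) f) t) = mk t := by
  classical
  exact mk_eq_mk (restricts_apply _ t) (apply_embedMat_restricts hf t)

/-- Two zero tensors (of any formats) have the same class (`d ≠ 0`). [cite: ChristandlVranaZuiddam2023, §1.2] -/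
theorem mk_eq_mk_of_eq_zero [NeZero d] [Fintype ι] [Fintype κ] {s : (Fin d → ι) → K}
    {t : (Fin d → κ) → K} (hs : s = 0) (ht : t = 0) : mk s = mk t := by
  subst hs; subst ht
  exact mk_eq_mk (Restricts.zero _) (Restricts.zero _)

/-! ## Semiring operations -/

/-- Addition on `T_d(K)`: `[s] + [t] = [s ⊕ t]`. [cite: ChristandlVranaZuiddam2023, §1.2] -/
instance : Add (DTensorClass K d) :=
  ⟨Quotient.map₂ (fun s t : DFinTensor K d => DFinTensor.ofFun (dsum s.val t.val))
    fun s s' hs t t' ht => by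
      refine ⟨?_, ?_⟩
      · exact (DFinTensor.ofFun_restricts _).trans
          ((hs.1.dsum ht.1).trans (DFinTensor.restricts_ofFun _))
      · exact (DFinTensor.ofFun_restricts _).trans
          ((hs.2.dsum ht.2).trans (DFinTensor.restricts_ofFun _))⟩

/-- Multiplication on `T_d(K)`: `[s] * [t] = [s ⊗ t]`. [cite: ChristandlVranaZuiddam2023, §1.2] -/
instance : Mul (DTensorClass K d) :=
  ⟨Quotient.map₂ (fun s t : DFinTensor K d => DFinTensor.ofFun (kron s.val t.val))
    fun s s' hs t t' ht => by
      refine ⟨?_, ?_⟩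
      · exact (DFinTensor.ofFun_restricts _).trans
          ((hs.1.kron ht.1).trans (DFinTensor.restricts_ofFun _))
      · exact (DFinTensor.ofFun_restricts _).trans
          ((hs.2.kron ht.2).trans (DFinTensor.restricts_ofFun _))⟩

variable (K d) in
/-- Natural numbers in `T_d(K)`: `n ↦ [⟨n⟩]` (the unit tensors). [cite: ChristandlVranaZuiddam2023, §1.2] -/
def natCast (n : ℕ) : DTensorClass K d := mk (unit K d (Fin n))

/-- `0 = [⟨0⟩]` ("additive unit `⟨0⟩`"). [cite: ChristandlVranaZuiddam2023, §1.2] -/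
instance : Zero (DTensorClass K d) := ⟨natCast K d 0⟩

/-- `1 = [⟨1⟩]` ("multiplicative unit `⟨1⟩`"). [cite: ChristandlVranaZuiddam2023, §1.2] -/
instance : One (DTensorClass K d) := ⟨natCast K d 1⟩

/-- **`[s] + [t] = [s ⊕ t]`** for arbitrary finite index types. [cite: ChristandlVranaZuiddam2023, §1.2] -/
theorem mk_add_mk [Fintype ι] [Fintype κ] [DecidableEq ι] [DecidableEq κ] (s : (Fin d → ι) → K)
    (t : (Fin d → κ) → K) : mk s + mk t = mk (dsum s t) := by
  show toAntisymmetrization _ (DFinTensor.ofFun (dsum (DFinTensor.ofFun s).val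
    (DFinTensor.ofFun t).val)) = mk _
  exact mk_eq_mk ((DFinTensor.restricts_ofFun s).dsum (DFinTensor.restricts_ofFun t))
    ((DFinTensor.ofFun_restricts s).dsum (DFinTensor.ofFun_restricts t))

/-- **`[s] * [t] = [s ⊗ t]`** for arbitrary finite index types. [cite: ChristandlVranaZuiddam2023, §1.2] -/
theorem mk_mul_mk [Fintype ι] [Fintype κ] (s : (Fin d → ι) → K) (t : (Fin d → κ) → K) :
    mk s * mk t = mk (kron s t) := by
  show toAntisymmetrization _ (DFinTensor.ofFun (kron (DFinTensor.ofFun s).val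
    (DFinTensor.ofFun t).val)) = mk _
  exact mk_eq_mk ((DFinTensor.restricts_ofFun s).kron (DFinTensor.restricts_ofFun t))
    ((DFinTensor.ofFun_restricts s).kron (DFinTensor.ofFun_restricts t))

/-- `(n : T_d(K)) = [⟨n⟩]` (by definition). [cite: ChristandlVranaZuiddam2023, §1.2] -/
theorem natCast_def (n : ℕ) : natCast K d n = mk (unit K d (Fin n)) := rfl

/-- `0 = [⟨0⟩]`. [cite: ChristandlVranaZuiddam2023, §1.2] -/
theorem zero_def : (0 : DTensorClass K d) = mk (unit K d (Fin 0)) := rfl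

/-- `1 = [⟨1⟩]`. [cite: ChristandlVranaZuiddam2023, §1.2] -/
theorem one_def : (1 : DTensorClass K d) = mk (unit K d (Fin 1)) := rfl

/-- **`[⟨ι⟩] = [⟨|ι|⟩]`**: the class of a unit tensor is the natural number `|ι|`. [cite: ChristandlVranaZuiddam2023, §1.2] -/
theorem mk_unit [Fintype ι] [DecidableEq ι] : mk (unit K d ι) = natCast K d (Fintype.card ι) := by
  rw [natCast_def, ← mk_reindex (Fintype.equivFin ι) (unit K d ι), reindex_unit]

/-- The class of a tensor with empty index set is `0` (`d ≠ 0`). [cite: ChristandlVranaZuiddam2023, §1.2] -/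
theorem mk_eq_zero_of_isEmpty [NeZero d] [Fintype ι] [IsEmpty ι] (t : (Fin d → ι) → K) : mk t = 0 := by
  rw [zero_def]
  exact mk_eq_mk (restricts_of_isEmpty _ _) (restricts_of_isEmpty _ _)

/-- The class of any zero tensor is `0` (`d ≠ 0`). [cite: ChristandlVranaZuiddam2023, §1.2] -/
theorem mk_zero [NeZero d] [Fintype ι] : mk (0 : (Fin d → ι) → K) = 0 := by
  rw [← mk_eq_zero_of_isEmpty (ι := Fin 0) (K := K) (d := d) 0]
  exact mk_eq_mk_of_eq_zero rfl rfl

/-- The action on a tensor with empty index set is zero (`d ≠ 0`). [cite: ChristandlVranaZuiddam2023, §1.2] -/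
theorem apply_of_isEmpty [NeZero d] [Fintype ι] [IsEmpty ι] (A : Fin d → κ → ι → K)
    (t : (Fin d → ι) → K) : apply A t = 0 := by
  funext i
  rw [apply_apply_eq]
  haveI : IsEmpty (Fin d → ι) := ⟨fun k => isEmptyElim (k 0)⟩
  simp

/-! ## The commutative semiring `T_d(K)` -/

section Laws

variable [NeZero d]

omit [NeZero d] in
/-- `⊕` is associative up to relabelling (`Equiv.sumAssoc`). [cite: ChristandlVranaZuiddam2023, §1.2] -/
private theorem add_assoc' (x y z : DTensorClass K d) : x + y + z = x + (y + z) := by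
  induction x using ind with | _ n₁ s =>
  induction y using ind with | _ n₂ t =>
  induction z using ind with | _ n₃ u =>
  rw [mk_add_mk, mk_add_mk, mk_add_mk, mk_add_mk,
    ← mk_reindex (Equiv.sumAssoc (Fin n₁) (Fin n₂) (Fin n₃)) (dsum (dsum s t) u)]
  congr 1
  rw [reindex_dsum, apply_embedMat_dsum, dsum_def s (dsum t u), dsum_def t u, apply_add,
    apply_embedMat_apply_embedMat, apply_embedMat_apply_embedMat, add_assoc]
  rfl

omit [NeZero d] in
/-- `⊕` is commutative up to relabelling (`Equiv.sumComm`). [cite: ChristandlVranaZuiddam2023, §1.2] -/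
private theorem add_comm' (x y : DTensorClass K d) : x + y = y + x := by
  induction x using ind with | _ n₁ s =>
  induction y using ind with | _ n₂ t =>
  rw [mk_add_mk, mk_add_mk, ← mk_reindex (Equiv.sumComm (Fin n₂) (Fin n₁)) (dsum t s)]
  congr 1
  rw [reindex_dsum, dsum_def, add_comm]
  rfl

/-- `⟨0⟩ ⊕ t` is `t` pushed forward along `inr`. [cite: ChristandlVranaZuiddam2023, §1.2] -/
private theorem zero_add' (x : DTensorClass K d) : 0 + x = x := by
  induction x using ind with | _ n₁ s =>
  rw [zero_def, mk_add_mk, dsum_def, apply_of_isEmpty, zero_add]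
  exact mk_apply_embedMat Sum.inr_injective s

omit [NeZero d] in
/-- `⊗` is associative up to relabelling (`Equiv.prodAssoc`). [cite: ChristandlVranaZuiddam2023, §1.2] -/
private theorem mul_assoc' (x y z : DTensorClass K d) : x * y * z = x * (y * z) := by
  induction x using ind with | _ n₁ s =>
  induction y using ind with | _ n₂ t =>
  induction z using ind with | _ n₃ u =>
  rw [mk_mul_mk, mk_mul_mk, mk_mul_mk, mk_mul_mk,
    ← mk_reindex (Equiv.prodAssoc (Fin n₁) (Fin n₂) (Fin n₃)) (kron (kron s t) u)]
  congr 1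
  funext i
  simp [mul_assoc]

omit [NeZero d] in
/-- `⊗` is commutative up to relabelling (`Equiv.prodComm`). [cite: ChristandlVranaZuiddam2023, §1.2] -/
private theorem mul_comm' (x y : DTensorClass K d) : x * y = y * x := by
  induction x using ind with | _ n₁ s =>
  induction y using ind with | _ n₂ t =>
  rw [mk_mul_mk, mk_mul_mk, ← mk_reindex (Equiv.prodComm (Fin n₂) (Fin n₁)) (kron t s)]
  congr 1
  funext i
  simp [mul_comm]

omit [NeZero d] in
/-- `⟨1⟩ ⊗ t` is a relabelling of `t`. [cite: ChristandlVranaZuiddam2023, §1.2] -/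
private theorem one_mul' (x : DTensorClass K d) : 1 * x = x := by
  induction x using ind with | _ n₁ s =>
  rw [one_def, mk_mul_mk, ← mk_reindex (Equiv.uniqueProd (Fin n₁) (Fin 1)) (kron (unit K d (Fin 1)) s)]
  congr 1
  funext i
  simp [unit_apply]

/-- `⟨0⟩ ⊗ t` has an empty index set. [cite: ChristandlVranaZuiddam2023, §1.2] -/
private theorem zero_mul' (x : DTensorClass K d) : 0 * x = 0 := by
  induction x using ind with | _ n₁ s =>
  rw [zero_def, mk_mul_mk]
  exact mk_eq_zero_of_isEmpty _

omit [NeZero d] in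
/-- `s ⊗ (t ⊕ u)` is a relabelling of `s ⊗ t ⊕ s ⊗ u` (`Equiv.prodSumDistrib`). [cite: ChristandlVranaZuiddam2023, §1.2] -/
private theorem left_distrib' (x y z : DTensorClass K d) : x * (y + z) = x * y + x * z := by
  induction x using ind with | _ n₁ s =>
  induction y using ind with | _ n₂ t =>
  induction z using ind with | _ n₃ u =>
  rw [mk_add_mk, mk_mul_mk, mk_mul_mk, mk_mul_mk, mk_add_mk,
    ← mk_reindex (Equiv.prodSumDistrib (Fin n₁) (Fin n₂) (Fin n₃)).symm
      (dsum (kron s t) (kron s u))]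
  congr 1
  rw [reindex_dsum, dsum_def, kron_add, kron_apply_embedMat, kron_apply_embedMat]
  have h₁ : (⇑(Equiv.prodSumDistrib (Fin n₁) (Fin n₂) (Fin n₃)).symm ∘ Sum.inl) =
      Prod.map id Sum.inl := by
    funext x; obtain ⟨a, b⟩ := x; simp
  have h₂ : (⇑(Equiv.prodSumDistrib (Fin n₁) (Fin n₂) (Fin n₃)).symm ∘ Sum.inr) =
      Prod.map id Sum.inr := by
    funext x; obtain ⟨a, b⟩ := x; simp
  rw [h₁, h₂]

omit [NeZero d] in
/-- `(s ⊕ t) ⊗ u` is a relabelling of `s ⊗ u ⊕ t ⊗ u` (`Equiv.sumProdDistrib`). [cite: ChristandlVranaZuiddam2023, §1.2] -/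
private theorem right_distrib' (x y z : DTensorClass K d) : (x + y) * z = x * z + y * z := by
  induction x using ind with | _ n₁ s =>
  induction y using ind with | _ n₂ t =>
  induction z using ind with | _ n₃ u =>
  rw [mk_add_mk, mk_mul_mk, mk_mul_mk, mk_mul_mk, mk_add_mk,
    ← mk_reindex (Equiv.sumProdDistrib (Fin n₁) (Fin n₂) (Fin n₃)).symm
      (dsum (kron s u) (kron t u))]
  congr 1
  rw [reindex_dsum, dsum_def, add_kron, apply_embedMat_kron, apply_embedMat_kron]
  have h₁ : (⇑(Equiv.sumProdDistrib (Fin n₁) (Fin n₂) (Fin n₃)).symm ∘ Sum.inl) =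
      Prod.map Sum.inl id := by
    funext x; obtain ⟨a, b⟩ := x; simp
  have h₂ : (⇑(Equiv.sumProdDistrib (Fin n₁) (Fin n₂) (Fin n₃)).symm ∘ Sum.inr) =
      Prod.map Sum.inr id := by
    funext x; obtain ⟨a, b⟩ := x; simp
  rw [h₁, h₂]

/-- `[⟨n + 1⟩] = [⟨n⟩] + 1`: `⟨n⟩ ⊕ ⟨1⟩ = ⟨Fin n ⊕ Fin 1⟩` is a relabelling of `⟨n + 1⟩`. [cite: ChristandlVranaZuiddam2023, §1.2] -/
private theorem natCast_succ' (n : ℕ) : natCast K d (n + 1) = natCast K d n + 1 := by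
  rw [natCast_def, natCast_def, one_def, mk_add_mk, dsum_unit_unit,
    ← mk_reindex finSumFinEquiv (unit K d (Fin n ⊕ Fin 1)), reindex_unit]

/-- **`T_d(K)` is a commutative semiring** under `⊕` and `⊗`, with `0 = [⟨0⟩]`, `1 = [⟨1⟩]` and
`n = [⟨n⟩]` (CVZ 2023, §1.2; Zuiddam 2018, §2.3), for `d ≠ 0`. [cite: ChristandlVranaZuiddam2023, §1.2] -/
instance : CommSemiring (DTensorClass K d) where
  add_assoc := add_assoc'
  zero_add := zero_add'
  add_zero x := by rw [add_comm', zero_add']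
  add_comm := add_comm'
  left_distrib := left_distrib'
  right_distrib := right_distrib'
  zero_mul := zero_mul'
  mul_zero x := by rw [mul_comm', zero_mul']
  mul_assoc := mul_assoc'
  one_mul := one_mul'
  mul_one x := by rw [mul_comm', one_mul']
  mul_comm := mul_comm'
  natCast := natCast K d
  natCast_zero := rfl
  natCast_succ := natCast_succ'
  nsmul := nsmulRec
  npow := npowRec

/-- **`(n : T_d(K)) = [⟨n⟩]`**: the naturals of the semiring `T_d(K)` are the unit tensors
(CVZ §1.2 "naturally `n ≥ m` if and only if `⟨n⟩ ≥ ⟨m⟩`"). [cite: ChristandlVranaZuiddam2023, §1.2] -/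
theorem natCast_eq_mk (n : ℕ) : (n : DTensorClass K d) = mk (unit K d (Fin n)) := rfl

/-- `[⟨ι⟩] = |ι|` in the semiring `T_d(K)`. [cite: ChristandlVranaZuiddam2023, §1.2] -/
theorem mk_unit_eq_natCast [Fintype ι] [DecidableEq ι] :
    mk (unit K d ι) = (Fintype.card ι : DTensorClass K d) :=
  mk_unit

/-- `0 ≤ x` for every `x ∈ T_d(K)` (every tensor restricts to a zero tensor). [cite: ChristandlVranaZuiddam2023, §1.2] -/
theorem zero_le (x : DTensorClass K d) : 0 ≤ x := by
  induction x using ind with | _ n t =>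
  rw [← mk_zero (ι := Fin 0), mk_le_mk_iff]
  exact Restricts.zero _

omit [NeZero d] in
/-- **Compatibility with `+`**: `x ≤ y → z ≤ w → x + z ≤ y + w` (Zuiddam 2018, §2.3 (2); CVZ §1.2
"behave well with respect to the semiring operations"). [cite: ChristandlVranaZuiddam2023, §1.2] -/
theorem add_le_add {x y z w : DTensorClass K d} (h : x ≤ y) (h' : z ≤ w) : x + z ≤ y + w := by
  induction x using ind with | _ n₁ s =>
  induction y using ind with | _ n₂ t =>
  induction z using ind with | _ n₃ s' =>
  induction w using ind with | _ n₄ t' =>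
  rw [mk_add_mk, mk_add_mk, mk_le_mk_iff]
  rw [mk_le_mk_iff] at h h'
  exact h.dsum h'

omit [NeZero d] in
/-- **Compatibility with `*`**: `x ≤ y → z ≤ w → x * z ≤ y * w` (Zuiddam 2018, §2.3 (2)). [cite: ChristandlVranaZuiddam2023, §1.2] -/
theorem mul_le_mul {x y z w : DTensorClass K d} (h : x ≤ y) (h' : z ≤ w) : x * z ≤ y * w := by
  induction x using ind with | _ n₁ s =>
  induction y using ind with | _ n₂ t =>
  induction z using ind with | _ n₃ s' =>
  induction w using ind with | _ n₄ t' =>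
  rw [mk_mul_mk, mk_mul_mk, mk_le_mk_iff]
  rw [mk_le_mk_iff] at h h'
  exact h.kron h'

/-- Every class is below some natural number: `[t] ≤ |ι|^{d-1}` for `t` with index set `ι` — every tensor
is a restriction of the unit tensor on the index set `Fin (d-1) → ι` (CVZ §1.2, the rank is finite).
[cite: ChristandlVranaZuiddam2023, §1.2] -/
theorem mk_le_natCast_card {d' : ℕ} [Fintype ι] [DecidableEq ι] (t : (Fin (d' + 1) → ι) → K) :
    mk t ≤ (Fintype.card (Fin d' → ι) : DTensorClass K (d' + 1)) := by
  rw [← mk_unit_eq_natCast, mk_le_mk_iff]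
  refine ⟨Fin.cases (fun a c => t (Fin.cons a c)) (fun j x c => if c j = x then (1 : K) else 0), ?_⟩
  funext i
  rw [apply_unit, Finset.sum_eq_single (Fin.tail i)]
  · rw [Fin.prod_univ_succ, Fin.cases_zero]
    simp [Fin.tail, Fin.cons_self_tail]
  · intro c _ hc
    rw [Fin.prod_univ_succ, Fin.cases_zero]
    obtain ⟨j, hj⟩ : ∃ j, c j ≠ Fin.tail i j := by
      by_contra hall
      push Not at hall
      exact hc (funext hall)
    rw [Finset.prod_eq_zero (Finset.mem_univ j), mul_zero]
    simp only [Fin.cases_succ]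
    rw [if_neg]
    exact hj
  · simp

/-- Every class of `T_d(K)` (`d ≥ 1`) is below some natural number. [cite: ChristandlVranaZuiddam2023, §1.2] -/
theorem exists_le_natCast {d' : ℕ} (x : DTensorClass K (d' + 1)) : ∃ r : ℕ, x ≤ (r : DTensorClass K (d' + 1)) := by
  induction x using ind with | _ n t =>
  exact ⟨_, mk_le_natCast_card t⟩

end Laws

end DTensorClass

end Literature.Computability.AlgebraicComplexity

end
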